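import Literature.Probability.RandomPlanarGeometry.ArgMonotone
import Literature.Probability.RandomPlanarGeometry.CurveMonotoneReparam
import HarnessLib

/-!
# A counterclockwise polyline hugging a circle is close to the arc in the path metric `ρ`

The reparametrisation bound behind `USTPeano.IsApproximation` for the disc approximations
([LSW04] §4.3, `ρ(α^R, Rα_D) ≤ C`): for a polyline `c = pathCurve L` as in
`ArgMonotone.lean` (vertices in the closed upper half-plane, edges seen counterclockwise from `0`,
no negative-real vertex before the last) whose points have norm within `δ` of `ρ > 0`, and the
arc `t ↦ ρ e^{iπ(θ₀ + (θ₁ - θ₀) t)}` between the directions `πθ₀ = arg (c 0)` and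
`πθ₁ = arg (c 1)`, the reparametrisation distance is at most `δ`: the polyline is at sup-distance
`≤ δ` from its radial projection `t ↦ ρ e^{i arg (c t)}` (`radialCurve`), and the radial
projection is a monotone reparametrisation of the arc (`Curve.reparamDist_eq_zero_of_monotone'`,
the perturbation lemma of `CurveMonotoneReparam.lean`, with the monotone continuous time change
`arg ∘ c / π`).

* `circleArcCurve ρ θ₀ θ₁` (named so as not to collide with `MarkedDomain.arcCurve`),
  `radialCurve`, `dist_radialCurve_le`, `reparamDist_radialCurve_circleArcCurve`,
  `reparamDist_pathCurve_circleArcCurve_le`;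
* `dist_circleArcCurve_circleArcCurve_le` — two arcs with nearby angle ranges are sup-close
  (`Complex.norm_exp_mul_I_sub_exp_mul_I_le` of `Analysis/Complex/BoundaryUniqueness.lean`), for
  the renormalisation at the endpoints.
-/

noncomputable section

open Set Function Complex Real
open scoped unitInterval

namespace Literature.Probability.RandomPlanarGeometry

open USTPeano (pathCurve pathCurve_apply)
open Curve

/-! ### Arcs of a circle as curves -/

/-- The arc `t ↦ ρ e^{iπ(θ₀ + (θ₁ - θ₀) t)}` of the circle of radius `ρ`. [folklore] -/
def circleArcCurve (ρ θ₀ θ₁ : ℝ) : Curve ℂ :=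
  ⟨⟨fun t : I ↦ (ρ : ℂ) * exp ((Real.pi * (θ₀ + (θ₁ - θ₀) * (t : ℝ)) : ℝ) * Complex.I), by fun_prop⟩⟩

/-- Value of `circleArcCurve`. [folklore] -/
theorem circleArcCurve_apply (ρ θ₀ θ₁ : ℝ) (t : I) :
    circleArcCurve ρ θ₀ θ₁ t = (ρ : ℂ) * exp ((Real.pi * (θ₀ + (θ₁ - θ₀) * (t : ℝ)) : ℝ) * Complex.I) := rfl

/-- **Two arcs of the same circle with nearby angle schedules are sup-close**:
`dist ≤ ρ π (|θ₀ - θ₀'| + |θ₁ - θ₁'|)`. [folklore] -/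
theorem dist_circleArcCurve_circleArcCurve_le {ρ : ℝ} (hρ : 0 ≤ ρ) (θ₀ θ₁ θ₀' θ₁' : ℝ) :
    dist (circleArcCurve ρ θ₀ θ₁).toContinuousMap (circleArcCurve ρ θ₀' θ₁').toContinuousMap ≤
      ρ * Real.pi * (|θ₀ - θ₀'| + |θ₁ - θ₁'|) := by
  refine (ContinuousMap.dist_le (by positivity)).2 fun t ↦ ?_
  change dist (circleArcCurve ρ θ₀ θ₁ t) (circleArcCurve ρ θ₀' θ₁' t) ≤ _
  rw [circleArcCurve_apply, circleArcCurve_apply, dist_eq_norm, ← mul_sub, norm_mul, Complex.norm_real,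
    Real.norm_eq_abs, abs_of_nonneg hρ, mul_assoc]
  refine mul_le_mul_of_nonneg_left ?_ hρ
  refine (Complex.norm_exp_mul_I_sub_exp_mul_I_le _ _).trans ?_
  rw [← mul_sub, abs_mul, abs_of_pos Real.pi_pos]
  refine mul_le_mul_of_nonneg_left ?_ Real.pi_pos.le
  have ht0 := t.2.1
  have ht1 := t.2.2
  calc |θ₀ + (θ₁ - θ₀) * t - (θ₀' + (θ₁' - θ₀') * t)|
      = |(1 - t) * (θ₀ - θ₀') + t * (θ₁ - θ₁')| := by ring_nf
    _ ≤ |(1 - t) * (θ₀ - θ₀')| + |t * (θ₁ - θ₁')| := abs_add_le _ _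
    _ = (1 - t) * |θ₀ - θ₀'| + t * |θ₁ - θ₁'| := by
        rw [abs_mul, abs_mul, abs_of_nonneg (by linarith), abs_of_nonneg ht0]
    _ ≤ |θ₀ - θ₀'| + |θ₁ - θ₁'| := by
        nlinarith [abs_nonneg (θ₀ - θ₀'), abs_nonneg (θ₁ - θ₁')]

/-! ### The radial projection of a counterclockwise polyline -/

section Radial

variable {L : List ℂ} (hL : 2 ≤ L.length) (him : ∀ p ∈ L, 0 ≤ p.im)
  (hc : L.IsChain fun p q ↦ 0 < cross p q) (hslit : L.IsChain fun p _ ↦ 0 < p.im ∨ 0 < p.re)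

/-- The angle schedule `arg (pathCurve L ·) / π`, extended to `ℝ` by projection onto `[0, 1]`.
[folklore] -/
def angleFun (L : List ℂ) (x : ℝ) : ℝ := arg (pathCurve L (projIcc 0 1 zero_le_one x)) / Real.pi

include hL him hc in
/-- The angle schedule is monotone. [folklore] -/
theorem monotone_angleFun : Monotone (angleFun L) := fun _ _ h ↦
  div_le_div_of_nonneg_right (monotone_arg_pathCurve hL him hc (monotone_projIcc _ h)) Real.pi_pos.le

include hL him hc hslit in
/-- The angle schedule is continuous. [folklore] -/
theorem continuous_angleFun : Continuous (angleFun L) :=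
  ((continuous_arg_pathCurve hL him hc hslit).comp continuous_projIcc).div_const _

/-- On `[0, 1]` the angle schedule is `arg (pathCurve L t) / π`. [folklore] -/
theorem angleFun_coe (L : List ℂ) (t : I) : angleFun L t = arg (pathCurve L t) / Real.pi := by
  simp [angleFun, projIcc_val]

/-- **The radial projection** `t ↦ ρ e^{i arg (c t)}` of the polyline onto the circle of radius `ρ`,
as a curve: it is the arc `circleArcCurve ρ (angleFun L 0) (angleFun L 1)` run with the time change
`angleFun L`. [folklore] -/
def radialCurve (L : List ℂ) (ρ : ℝ) (hcont : Continuous (angleFun L)) : Curve ℂ :=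
  ⟨⟨fun t : I ↦ (ρ : ℂ) * exp ((Real.pi * angleFun L t : ℝ) * Complex.I), by
    have : Continuous fun t : I ↦ angleFun L t := hcont.comp continuous_subtype_val
    fun_prop⟩⟩

/-- Value of the radial projection: `ρ · c t / ‖c t‖`. [folklore] -/
theorem radialCurve_apply (L : List ℂ) (ρ : ℝ) (hcont : Continuous (angleFun L)) (t : I)
    (h0 : pathCurve L t ≠ 0) :
    radialCurve L ρ hcont t = ((ρ / ‖pathCurve L t‖ : ℝ) : ℂ) * pathCurve L t := by
  change (ρ : ℂ) * exp ((Real.pi * angleFun L t : ℝ) * Complex.I) = _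
  rw [angleFun_coe, mul_div_cancel₀ _ Real.pi_pos.ne']
  have key := Complex.norm_mul_exp_arg_mul_I (pathCurve L t)
  have hn : (‖pathCurve L t‖ : ℂ) ≠ 0 := by exact_mod_cast (norm_pos_iff.2 h0).ne'
  have : exp ((arg (pathCurve L t) : ℂ) * Complex.I) = pathCurve L t / ‖pathCurve L t‖ := by
    rw [eq_div_iff hn, mul_comm, key]
  rw [this]
  push_cast
  field_simp

include hL hc in
/-- **The polyline is sup-close to its radial projection**: if all its points have norm in
`[ρ - δ, ρ + δ]` then `dist ≤ δ`. [folklore] -/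
theorem dist_radialCurve_le {ρ δ : ℝ} (hδ : 0 ≤ δ) (hcont : Continuous (angleFun L))
    (hnorm : ∀ t : I, ρ - δ ≤ ‖pathCurve L t‖ ∧ ‖pathCurve L t‖ ≤ ρ + δ) :
    dist (pathCurve L).toContinuousMap (radialCurve L ρ hcont).toContinuousMap ≤ δ := by
  refine (ContinuousMap.dist_le hδ).2 fun t ↦ ?_
  change dist (pathCurve L t) (radialCurve L ρ hcont t) ≤ δ
  have h0 := pathCurve_ne_zero hL hc t
  have hn := norm_pos_iff.2 h0
  rw [radialCurve_apply L ρ hcont t h0, dist_eq_norm]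
  have : pathCurve L t - ((ρ / ‖pathCurve L t‖ : ℝ) : ℂ) * pathCurve L t =
      ((1 - ρ / ‖pathCurve L t‖ : ℝ) : ℂ) * pathCurve L t := by push_cast; ring
  rw [this, norm_mul, Complex.norm_real, Real.norm_eq_abs]
  have : |1 - ρ / ‖pathCurve L t‖| * ‖pathCurve L t‖ = |‖pathCurve L t‖ - ρ| := by
    rw [← abs_of_pos hn, ← abs_mul, abs_of_pos hn]
    congr 1
    field_simp
  rw [this, abs_le]
  obtain ⟨h1, h2⟩ := hnorm t
  constructor <;> linarith

include hL him hc hslit in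
/-- **The radial projection is a monotone reparametrisation of the arc** between its end
directions: reparametrisation distance `0` (the tree's perturbation lemma
`Curve.reparamDist_eq_zero_of_monotone'`). [folklore] -/
theorem reparamDist_radialCurve_circleArcCurve (ρ : ℝ) (hcont : Continuous (angleFun L)) :
    reparamDist (radialCurve L ρ hcont) (circleArcCurve ρ (angleFun L 0) (angleFun L 1)) = 0 := by
  set θ₀ := angleFun L 0
  set θ₁ := angleFun L 1
  have hmono := monotone_angleFun hL him hc
  have h01 : θ₀ ≤ θ₁ := hmono zero_le_one
  -- the common arc `V x = ρ e^{iπ(θ₀ + x)}` on `[0, θ₁ - θ₀]`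
  set V : ℝ → ℂ := fun x ↦ (ρ : ℂ) * exp ((Real.pi * (θ₀ + x) : ℝ) * Complex.I)
  have hV : ContinuousOn V (Icc 0 (θ₁ - θ₀)) := by
    apply Continuous.continuousOn; simp only [V]; fun_prop
  -- the two time changes
  set h₁ : ℝ → ℝ := fun x ↦ angleFun L x - θ₀
  set h₂ : ℝ → ℝ := fun x ↦ (θ₁ - θ₀) * (projIcc 0 1 zero_le_one x : ℝ)
  refine Curve.reparamDist_eq_zero_of_monotone' (sub_nonneg.2 h01) hV (h₁ := h₁) (h₂ := h₂)
    ((continuous_angleFun hL him hc hslit).sub continuous_const)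
    (continuous_const.mul (continuous_subtype_val.comp continuous_projIcc))
    (fun a b hab ↦ sub_le_sub_right (hmono hab) _)
    (fun a b hab ↦ mul_le_mul_of_nonneg_left (Subtype.coe_le_coe.2 (monotone_projIcc _ hab))
      (sub_nonneg.2 h01))
    (by simp [h₁, θ₀]) (by simp [h₂, projIcc]) (by simp [h₁, θ₁]) (by simp [h₂, projIcc]) ?_ ?_
  · intro t
    change (ρ : ℂ) * exp ((Real.pi * angleFun L t : ℝ) * Complex.I) = V (h₁ t)
    simp only [V, h₁]
    ring_nf
  · intro t
    rw [circleArcCurve_apply]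
    simp only [V, h₂, projIcc_val]

include hL him hc hslit in
/-- **A counterclockwise polyline hugging a circle is `ρ`-close to the arc between its end
directions**: with all points of norm in `[ρ - δ, ρ + δ]`,
`reparamDist (pathCurve L) (circleArcCurve ρ θ₀ θ₁) ≤ δ` where `πθ₀ = arg (c 0)`, `πθ₁ = arg (c 1)`.
[folklore] -/
theorem reparamDist_pathCurve_circleArcCurve_le {ρ δ : ℝ} (hδ : 0 ≤ δ)
    (hnorm : ∀ t : I, ρ - δ ≤ ‖pathCurve L t‖ ∧ ‖pathCurve L t‖ ≤ ρ + δ) :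
    reparamDist (pathCurve L) (circleArcCurve ρ (angleFun L 0) (angleFun L 1)) ≤ δ := by
  have hcont := continuous_angleFun hL him hc hslit
  calc reparamDist (pathCurve L) (circleArcCurve ρ (angleFun L 0) (angleFun L 1))
      ≤ reparamDist (pathCurve L) (radialCurve L ρ hcont) +
          reparamDist (radialCurve L ρ hcont) (circleArcCurve ρ (angleFun L 0) (angleFun L 1)) :=
        reparamDist_triangle _ _ _
    _ ≤ δ + 0 := by
        gcongr
        · exact (reparamDist_le_dist _ _).trans (dist_radialCurve_le hL hc hδ hcont hnorm)
        · exact (reparamDist_radialCurve_circleArcCurve hL him hc hslit ρ hcont).le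
    _ = δ := add_zero _

end Radial

end Literature.Probability.RandomPlanarGeometry
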